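import Summits.FinalStateConjecture.FinalStateConjecture.Theorems.SwallowTheDatumParametricKerrBurialCappingCorners
import HarnessLib

/-!
# `ParametricKerrBurial`, line `null-shell-shadow-collar` — stub `stub_capping`, II: the profile of the cap

Support file (everything proved; no definitions, no named facts) for stub `stub_capping` of crux
`stmt-FinalStateConjecture-10052` (`Summit.FinalStateConjecture.FinalStateConjecture.Theses.SwallowTheDatum.ParametricKerrBurial`),
continuing `…CappingCorners` (the corners `H`, `K`, the height `τ(s) = ε H((s − s₁)/ε)` and the outer radial chart
`ϱ₃(s) = s + d − d S(s − s₁ − 1)`). Here: the radial profile `ϱ(s) = ϱ₃(s) − ε K((s − s₁ + 2ε)/ε)` (`≡ r₀` on the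
cylinder part `s ≤ s₁ − 2ε`, a monotone radial start on `(s₁ − 2ε, s₁ − ε)`, `= ϱ₃` from `s₁ − ε` on) and the packaged
profile of the cap `exists_cappingProfile` with `ε := (2m − r₀)/4`, `s₁ := max ρ₂ (r₀ + 2ε) + 1`, `d := r₀ + 2ε − s₁`,
listing exactly what the geometry consumes: the zone formulas, `τ′, ϱ′ ≥ 0`, the SPACELIKE inequality
`−τ′² + ϱ′² + (2m/ϱ)(τ′ + ϱ′)² > 0` (from `≥ τ′²(2m/ϱ − 1) + ϱ′²(1 + 2m/ϱ)`: where `t*` moves `ϱ < 2m`, elsewhere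
`ϱ′ ≥ 1`) and the FUTURE inequality `ϱ′ + (2m/ϱ)(ϱ′ + τ′) > 0` of the radial immersion `y ↦ (τ(s), (ϱ(s)/s) y)`.

References: Li–Mei arXiv:2005.01249 §4 (the spacelike cylinder `{r = r₀ < 2m}`); O'Neill 1983, Ch. 13.
-/

-- the doubled `FinalStateConjecture` path component is the summit/problem naming scheme, not a mistake
set_option linter.dupNamespace false

noncomputable section

open Real Set Filter Topology
open scoped ContDiff Topology
open Literature.Analysis.Calculus (differentiable_smoothTransition deriv_smoothTransition_of_nonpos
  deriv_smoothTransition_of_one_le)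

namespace Summit.FinalStateConjecture.FinalStateConjecture.Theorems.SwallowTheDatum.ParametricKerrBurial

namespace Capping

/-! ### The radial profile `ϱ(s) = ϱ₃(s) − ε K((s − s₁ + 2ε)/ε)` -/

section Radial

variable {ε d s₁ : ℝ}

/-- The radial profile is `C^∞`. [folklore] -/
theorem contDiff_radial :
    ContDiff ℝ ∞ (fun s : ℝ ↦ s + d - d * smoothTransition (s - s₁ - 1) -
      ε * ((s - s₁ + 2 * ε) / ε * (1 - smoothTransition ((s - s₁ + 2 * ε) / ε)))) := by
  have hin : ContDiff ℝ ∞ (fun s : ℝ ↦ (s - s₁ + 2 * ε) / ε) :=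
    ((contDiff_id.sub contDiff_const).add contDiff_const).div_const ε
  exact contDiff_outer.sub (contDiff_const.mul (contDiff_startCorner.comp hin))

/-- The derivative of the radial profile is `1 − d S′(s − s₁ − 1) − K′((s − s₁ + 2ε)/ε)`. [folklore] -/
theorem hasDerivAt_radial (hε : 0 < ε) (s : ℝ) :
    HasDerivAt (fun s : ℝ ↦ s + d - d * smoothTransition (s - s₁ - 1) -
      ε * ((s - s₁ + 2 * ε) / ε * (1 - smoothTransition ((s - s₁ + 2 * ε) / ε))))
      ((1 - d * deriv smoothTransition (s - s₁ - 1)) -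
        deriv (fun x : ℝ ↦ x * (1 - smoothTransition x)) ((s - s₁ + 2 * ε) / ε)) s := by
  have hin : HasDerivAt (fun s : ℝ ↦ (s - s₁ + 2 * ε) / ε) ε⁻¹ s := by
    simpa [div_eq_mul_inv] using (((hasDerivAt_id' s).sub_const s₁).add_const (2 * ε)).mul_const ε⁻¹
  have hK := ((hasDerivAt_startCorner ((s - s₁ + 2 * ε) / ε)).comp s hin).const_mul ε
  have h := (hasDerivAt_outer (d := d) (s₁ := s₁) s).fun_sub hK
  rw [(hasDerivAt_startCorner ((s - s₁ + 2 * ε) / ε)).deriv]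
  refine h.congr_deriv ?_
  field_simp

/-- The derivative of the radial profile, as a `deriv`. [folklore] -/
theorem deriv_radial (hε : 0 < ε) (s : ℝ) :
    deriv (fun s : ℝ ↦ s + d - d * smoothTransition (s - s₁ - 1) -
      ε * ((s - s₁ + 2 * ε) / ε * (1 - smoothTransition ((s - s₁ + 2 * ε) / ε)))) s =
      (1 - d * deriv smoothTransition (s - s₁ - 1)) -
        deriv (fun x : ℝ ↦ x * (1 - smoothTransition x)) ((s - s₁ + 2 * ε) / ε) :=
  (hasDerivAt_radial hε s).deriv

/-- On the cylinder part `s ≤ s₁ − 2ε` the radius is the constant `s₁ + d − 2ε` (`= r₀`). [folklore] -/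
theorem radial_of_le (hε : 0 < ε) {s : ℝ} (hs : s ≤ s₁ - 2 * ε) :
    s + d - d * smoothTransition (s - s₁ - 1) -
      ε * ((s - s₁ + 2 * ε) / ε * (1 - smoothTransition ((s - s₁ + 2 * ε) / ε))) = s₁ + d - 2 * ε := by
  have hx : (s - s₁ + 2 * ε) / ε ≤ 0 := div_nonpos_of_nonpos_of_nonneg (by linarith) hε.le
  rw [startCorner_of_nonpos hx, outer_of_le (by linarith)]
  field_simp
  ring

/-- From `s₁ − ε` on the radius is the outer profile `ϱ₃`. [folklore] -/
theorem radial_of_ge (hε : 0 < ε) {s : ℝ} (hs : s₁ - ε ≤ s) :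
    s + d - d * smoothTransition (s - s₁ - 1) -
      ε * ((s - s₁ + 2 * ε) / ε * (1 - smoothTransition ((s - s₁ + 2 * ε) / ε))) =
      s + d - d * smoothTransition (s - s₁ - 1) := by
  have hx : 1 ≤ (s - s₁ + 2 * ε) / ε := by rw [le_div_iff₀ hε]; linarith
  rw [startCorner_of_one_le hx, mul_zero, sub_zero]

/-- On the cylinder part the radius has derivative `0`. [folklore] -/
theorem deriv_radial_of_le (hε : 0 < ε) {s : ℝ} (hs : s ≤ s₁ - 2 * ε) :
    deriv (fun s : ℝ ↦ s + d - d * smoothTransition (s - s₁ - 1) -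
      ε * ((s - s₁ + 2 * ε) / ε * (1 - smoothTransition ((s - s₁ + 2 * ε) / ε)))) s = 0 := by
  have hx : (s - s₁ + 2 * ε) / ε ≤ 0 := div_nonpos_of_nonpos_of_nonneg (by linarith) hε.le
  rw [deriv_radial hε, deriv_startCorner_of_nonpos hx, deriv_smoothTransition_of_nonpos (by linarith)]
  ring

/-- From `s₁ − ε` on the radius has the derivative of the outer profile, hence slope `≥ 1` (`d ≤ 0`). [folklore] -/
theorem one_le_deriv_radial_of_ge (hε : 0 < ε) (hd : d ≤ 0) {s : ℝ} (hs : s₁ - ε ≤ s) :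
    1 ≤ deriv (fun s : ℝ ↦ s + d - d * smoothTransition (s - s₁ - 1) -
      ε * ((s - s₁ + 2 * ε) / ε * (1 - smoothTransition ((s - s₁ + 2 * ε) / ε)))) s := by
  have hx : 1 ≤ (s - s₁ + 2 * ε) / ε := by rw [le_div_iff₀ hε]; linarith
  rw [deriv_radial hε, deriv_startCorner_of_one_le hx, sub_zero]
  have : d * deriv smoothTransition (s - s₁ - 1) ≤ 0 :=
    mul_nonpos_of_nonpos_of_nonneg hd smoothTransition.monotone.deriv_nonneg
  linarith

/-- **The radial profile is monotone** (`d ≤ 0`): `ϱ′ = (1 − K′) − d S′ ≥ 0`. [folklore] -/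
theorem deriv_radial_nonneg (hε : 0 < ε) (hd : d ≤ 0) (s : ℝ) :
    0 ≤ deriv (fun s : ℝ ↦ s + d - d * smoothTransition (s - s₁ - 1) -
      ε * ((s - s₁ + 2 * ε) / ε * (1 - smoothTransition ((s - s₁ + 2 * ε) / ε)))) s := by
  rw [deriv_radial hε]
  have h1 := deriv_startCorner_le_one ((s - s₁ + 2 * ε) / ε)
  have h2 : d * deriv smoothTransition (s - s₁ - 1) ≤ 0 :=
    mul_nonpos_of_nonpos_of_nonneg hd smoothTransition.monotone.deriv_nonneg
  linarith

end Radial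

/-! ### The profile of the cap -/

section Profile

variable {m r₀ ρ₂ : ℝ}

/-- **The spacelike inequality of a monotone radial profile**: for `τ′, ϱ′ ≥ 0` and `ϱ > 0`,
`−τ′² + ϱ′² + (2m/ϱ)(τ′ + ϱ′)² ≥ τ′²(2m/ϱ − 1) + ϱ′²(1 + 2m/ϱ)`. [folklore] -/
theorem spacelike_lower_bound {t r ϱ : ℝ} (ht : 0 ≤ t) (hr : 0 ≤ r) (hm : 0 ≤ m) (hϱ : 0 < ϱ) :
    t ^ 2 * (2 * m / ϱ - 1) + r ^ 2 * (1 + 2 * m / ϱ) ≤ -t ^ 2 + r ^ 2 + 2 * m / ϱ * (t + r) ^ 2 := by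
  have h2 : 0 ≤ 2 * m / ϱ := by positivity
  nlinarith [mul_nonneg h2 (mul_nonneg ht hr)]

/-- **The profile of the cap.** For `0 < r₀ < 2m` and any `ρ₂` there are `ε > 0` with `r₀ + 4ε = 2m`, a cut radius
`s₁ ≥ max ρ₂ (r₀ + 2ε) + 1`, the offset `d = r₀ + 2ε − s₁`, smooth profiles `τ, ϱ`, and a smooth strictly increasing
bijection `ϱ₃` of `ℝ` with smooth inverse `σ`, such that: `τ = s − s₁`, `ϱ = r₀` on the cylinder part; `τ = 0` from
`s₁` on; `ϱ = ϱ₃` from `s₁ − ε` on, `ϱ₃ = s + d` below `s₁ + 1`, `ϱ₃ = s` beyond `s₁ + 2`; `τ′, ϱ′ ≥ 0`, `τ′ = 1`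
below `s₁ − ε`, `ϱ′ ≥ 1` from `s₁ − ε` on; `r₀ ≤ ϱ`, `ϱ < 2m` up to `s₁ + ε`; and the spacelike and future
inequalities of the radial immersion hold everywhere. [folklore] -/
theorem exists_cappingProfile (hr₀ : 0 < r₀) (hr₀m : r₀ < 2 * m) (ρ₂ : ℝ) :
    ∃ (ε s₁ d : ℝ) (τ ϱ ϱ₃ σ : ℝ → ℝ),
      0 < ε ∧ r₀ + 4 * ε = 2 * m ∧ ρ₂ + 1 ≤ s₁ ∧ r₀ + 2 * ε + 1 ≤ s₁ ∧ d = r₀ + 2 * ε - s₁ ∧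
      ContDiff ℝ ∞ τ ∧ ContDiff ℝ ∞ ϱ ∧ ContDiff ℝ ∞ ϱ₃ ∧ ContDiff ℝ ∞ σ ∧ StrictMono ϱ₃ ∧ StrictMono σ ∧
      Monotone ϱ ∧ (∀ s, σ (ϱ₃ s) = s) ∧ (∀ r, ϱ₃ (σ r) = r) ∧
      (∀ s, s ≤ s₁ - ε → τ s = s - s₁) ∧ (∀ s, s₁ ≤ s → τ s = 0) ∧
      (∀ s, s ≤ s₁ - 2 * ε → ϱ s = r₀) ∧ (∀ s, s₁ - ε ≤ s → ϱ s = ϱ₃ s) ∧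
      (∀ s, s ≤ s₁ + 1 → ϱ₃ s = s + d) ∧ (∀ s, s₁ + 2 ≤ s → ϱ₃ s = s) ∧ (∀ s, 1 ≤ deriv ϱ₃ s) ∧
      (∀ s, 0 ≤ deriv τ s) ∧ (∀ s, 0 ≤ deriv ϱ s) ∧
      (∀ s, s ≤ s₁ - ε → deriv τ s = 1) ∧ (∀ s, s₁ ≤ s → deriv τ s = 0) ∧ (∀ s, s₁ - ε ≤ s → 1 ≤ deriv ϱ s) ∧
      (∀ s, r₀ ≤ ϱ s) ∧ (∀ s, s ≤ s₁ + min ε 1 → ϱ s < 2 * m) ∧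
      (∀ s, 0 < -(deriv τ s) ^ 2 + (deriv ϱ s) ^ 2 + 2 * m / ϱ s * (deriv τ s + deriv ϱ s) ^ 2) ∧
      (∀ s, 0 < deriv ϱ s + 2 * m / ϱ s * (deriv ϱ s + deriv τ s)) := by
  have hm : 0 < m := by linarith
  set ε := (2 * m - r₀) / 4 with hε_def
  have hε : 0 < ε := by rw [hε_def]; linarith
  have hε4 : r₀ + 4 * ε = 2 * m := by rw [hε_def]; ring
  set s₁ := max ρ₂ (r₀ + 2 * ε) + 1 with hs₁_def
  have hs₁ρ : ρ₂ + 1 ≤ s₁ := by rw [hs₁_def]; linarith [le_max_left ρ₂ (r₀ + 2 * ε)]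
  have hs₁r : r₀ + 2 * ε + 1 ≤ s₁ := by rw [hs₁_def]; linarith [le_max_right ρ₂ (r₀ + 2 * ε)]
  set d := r₀ + 2 * ε - s₁ with hd_def
  have hd : d ≤ 0 := by rw [hd_def]; linarith
  set τ : ℝ → ℝ := fun s ↦ ε * ((s - s₁) / ε * (1 - smoothTransition ((s - s₁) / ε + 1))) with hτ_def
  set ϱ₃ : ℝ → ℝ := fun s ↦ s + d - d * smoothTransition (s - s₁ - 1) with hϱ₃_def
  set ϱ : ℝ → ℝ := fun s ↦ s + d - d * smoothTransition (s - s₁ - 1) -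
      ε * ((s - s₁ + 2 * ε) / ε * (1 - smoothTransition ((s - s₁ + 2 * ε) / ε))) with hϱ_def
  obtain ⟨σ, hσs, hσm, hσϱ, hϱσ⟩ := exists_outer_inverse (s₁ := s₁) hd
  -- zone formulas
  have hτlo : ∀ s, s ≤ s₁ - ε → τ s = s - s₁ := fun s hs ↦ height_of_le hε hs
  have hτhi : ∀ s, s₁ ≤ s → τ s = 0 := fun s hs ↦ height_of_ge hε hs
  have hϱlo : ∀ s, s ≤ s₁ - 2 * ε → ϱ s = r₀ := fun s hs ↦ by
    show s + d - d * smoothTransition (s - s₁ - 1) -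
      ε * ((s - s₁ + 2 * ε) / ε * (1 - smoothTransition ((s - s₁ + 2 * ε) / ε))) = r₀
    rw [radial_of_le hε hs, hd_def]; ring
  have hϱhi : ∀ s, s₁ - ε ≤ s → ϱ s = ϱ₃ s := fun s hs ↦ radial_of_ge hε hs
  have hϱ₃lo : ∀ s, s ≤ s₁ + 1 → ϱ₃ s = s + d := fun s hs ↦ outer_of_le hs
  have hϱ₃hi : ∀ s, s₁ + 2 ≤ s → ϱ₃ s = s := fun s hs ↦ outer_of_ge hs
  have hϱ₃' : ∀ s, 1 ≤ deriv ϱ₃ s := fun s ↦ one_le_deriv_outer hd s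
  have hϱ₃c : ContDiff ℝ ∞ ϱ₃ := contDiff_outer
  have hϱ₃m : StrictMono ϱ₃ :=
    strictMono_of_deriv_pos fun s ↦ lt_of_lt_of_le one_pos (hϱ₃' s)
  -- derivatives
  have hτ'0 : ∀ s, 0 ≤ deriv τ s := fun s ↦ deriv_height_nonneg hε s
  have hϱ'0 : ∀ s, 0 ≤ deriv ϱ s := fun s ↦ deriv_radial_nonneg hε hd s
  have hτ'1 : ∀ s, s ≤ s₁ - ε → deriv τ s = 1 := fun s hs ↦ deriv_height_of_le hε hs
  have hτ'z : ∀ s, s₁ ≤ s → deriv τ s = 0 := fun s hs ↦ deriv_height_of_ge hε hs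
  have hϱ'1 : ∀ s, s₁ - ε ≤ s → 1 ≤ deriv ϱ s := fun s hs ↦ one_le_deriv_radial_of_ge hε hd hs
  -- values of `ϱ`
  have hϱc : ContDiff ℝ ∞ ϱ := contDiff_radial
  have hmono : Monotone ϱ := monotone_of_deriv_nonneg (hϱc.differentiable (by simp)) hϱ'0
  have hϱr₀ : ∀ s, r₀ ≤ ϱ s := fun s ↦ by
    rcases le_or_gt s (s₁ - 2 * ε) with hs | hs
    · rw [hϱlo s hs]
    · rw [← hϱlo (s₁ - 2 * ε) le_rfl]; exact hmono hs.le
  have hϱpos : ∀ s, 0 < ϱ s := fun s ↦ lt_of_lt_of_le hr₀ (hϱr₀ s)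
  have hϱ2m : ∀ s, s ≤ s₁ + min ε 1 → ϱ s < 2 * m := fun s hs ↦ by
    have h1 : ϱ s ≤ ϱ (s₁ + min ε 1) := hmono hs
    have h2 : ϱ (s₁ + min ε 1) = s₁ + min ε 1 + d := by
      rw [hϱhi _ (by linarith [lt_min hε one_pos]), hϱ₃lo _ (by linarith [min_le_right ε 1])]
    have h3 : s₁ + min ε 1 + d < 2 * m := by
      rw [hd_def]; linarith [min_le_left ε 1]
    linarith
  have hϱs₁ : ∀ s, s ≤ s₁ → ϱ s < 2 * m := fun s hs ↦
    hϱ2m s (by linarith [lt_min hε one_pos])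
  refine ⟨ε, s₁, d, τ, ϱ, ϱ₃, σ, hε, hε4, hs₁ρ, hs₁r, rfl, contDiff_height, hϱc, hϱ₃c, hσs, hϱ₃m, hσm,
    hmono, hσϱ, hϱσ, hτlo, hτhi, hϱlo, hϱhi, hϱ₃lo, hϱ₃hi, hϱ₃', hτ'0, hϱ'0, hτ'1, hτ'z, hϱ'1, hϱr₀, hϱ2m,
    fun s ↦ ?_, fun s ↦ ?_⟩
  · -- spacelike
    have hlb := spacelike_lower_bound (hτ'0 s) (hϱ'0 s) hm.le (hϱpos s)
    rcases le_or_gt s s₁ with hs | hs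
    · have hA : 0 < 2 * m / ϱ s - 1 := by
        rw [sub_pos, lt_div_iff₀ (hϱpos s)]; linarith [hϱs₁ s hs]
      have hB : 0 < 1 + 2 * m / ϱ s := by have := hϱpos s; positivity
      rcases le_or_gt s (s₁ - ε) with hs' | hs'
      · rw [hτ'1 s hs'] at hlb ⊢
        nlinarith [mul_nonneg (sq_nonneg (deriv ϱ s)) hB.le]
      · have h1 := hϱ'1 s hs'.le
        nlinarith [mul_nonneg (sq_nonneg (deriv τ s)) hA.le]
    · rw [hτ'z s hs.le]
      have h1 := hϱ'1 s (by linarith)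
      have hB : 0 < 2 * m / ϱ s := by have := hϱpos s; positivity
      nlinarith [mul_pos hB (mul_pos (lt_of_lt_of_le one_pos h1) (lt_of_lt_of_le one_pos h1))]
  · -- future
    have hB : 0 ≤ 2 * m / ϱ s := by have := hϱpos s; positivity
    rcases le_or_gt s (s₁ - ε) with hs | hs
    · rw [hτ'1 s hs]
      have hB' : 0 < 2 * m / ϱ s := by have := hϱpos s; positivity
      nlinarith [mul_nonneg hB (hϱ'0 s), hϱ'0 s]
    · have h1 := hϱ'1 s hs.le
      nlinarith [mul_nonneg hB (add_nonneg (hϱ'0 s) (hτ'0 s))]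

end Profile

end Capping

/-- **Registered export of this file** (sub-goal `capping_profile` of stub `stub_capping`, crux
`stmt-FinalStateConjecture-10052`): the profile of the cap and everything the radial immersion consumes,
`Capping.exists_cappingProfile`. [folklore] -/
theorem capping_profile :
    ∀ (m r₀ ρ₂ : ℝ), 0 < r₀ → r₀ < 2 * m → ∃ (ε s₁ d : ℝ) (τ ϱ ϱ₃ σ : ℝ → ℝ), 0 < ε ∧ r₀ + 4 * ε = 2 * m ∧ ρ₂ + 1 ≤ s₁ ∧ r₀ + 2 * ε + 1 ≤ s₁ ∧ d = r₀ + 2 * ε - s₁ ∧ ContDiff ℝ ∞ τ ∧ ContDiff ℝ ∞ ϱ ∧ ContDiff ℝ ∞ ϱ₃ ∧ ContDiff ℝ ∞ σ ∧ StrictMono ϱ₃ ∧ StrictMono σ ∧ Monotone ϱ ∧ (∀ s, σ (ϱ₃ s) = s) ∧ (∀ r, ϱ₃ (σ r) = r) ∧ (∀ s, s ≤ s₁ - ε → τ s = s - s₁) ∧ (∀ s, s₁ ≤ s → τ s = 0) ∧ (∀ s, s ≤ s₁ - 2 * ε → ϱ s = r₀) ∧ (∀ s, s₁ - ε ≤ s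 → ϱ s = ϱ₃ s) ∧ (∀ s, s ≤ s₁ + 1 → ϱ₃ s = s + d) ∧ (∀ s, s₁ + 2 ≤ s → ϱ₃ s = s) ∧ (∀ s, 1 ≤ deriv ϱ₃ s) ∧ (∀ s, 0 ≤ deriv τ s) ∧ (∀ s, 0 ≤ deriv ϱ s) ∧ (∀ s, s ≤ s₁ - ε → deriv τ s = 1) ∧ (∀ s, s₁ ≤ s → deriv τ s = 0) ∧ (∀ s, s₁ - ε ≤ s → 1 ≤ deriv ϱ s) ∧ (∀ s, r₀ ≤ ϱ s) ∧ (∀ s, s ≤ s₁ + min ε 1 → ϱ s < 2 * m) ∧ (∀ s, 0 < -(deriv τ s) ^ 2 + (deriv ϱ s) ^ 2 + 2 * m / ϱ s * (deriv τ s + deriv ϱ s) ^ 2) ∧ (∀ s, 0 < deriv ϱ s + 2 * m / ϱ s * (deriv ϱ s + deriv τ s)) :=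
  fun _ _ ρ₂ hr₀ hr₀m ↦ Capping.exists_cappingProfile hr₀ hr₀m ρ₂

end Summit.FinalStateConjecture.FinalStateConjecture.Theorems.SwallowTheDatum.ParametricKerrBurial

end
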